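import Literature.AlgebraicGeometry.Motives.ZarhinHodgeGroupTypePP
import Literature.AlgebraicGeometry.Motives.MumfordTateInvariantsTensorPairing
import Literature.AlgebraicGeometry.Motives.MumfordTateInvariantsDerivation
import HarnessLib

/-!
# Concatenation of tensors `T^{a,b} ⊗ T^{c,d} → T^{a+c,b+d}`: the Leibniz rule for the derivation action, degree additivity,
# and products of Hodge tensors of opposite types are weight-`0` Hodge tensors of type `(0,0)`

Family `hodge`, layer `Literature/AlgebraicGeometry/Motives`.  Theorems only; no definition, no named fact.  Written for the
cell `pub-hodgecm2` (COR-CM), seat `b27` gen 35 (count-neutral; stage β of the plan `𝔪𝔱 = ℚ·id ⊕ 𝔥`,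
`HOME/pub-hodgecm2-b27/MT-EQ-HG-PLAN.md`).  The concatenation is the tree's `tensorSpaceMulEquiv`
(`MumfordTateInvariantsTensorPairing`, Deligne I §3.1: the tensor algebra `⊕ T^{a,b}` and its product).

* §1 `piTensorDerivation_mulEquiv` and **`tensorDerivation_tensorSpaceMulEquiv`** — the derivation action of `Y ∈ End(W)` is a
  derivation of the concatenation product: `ρ(Y)(s · s') = ρ(Y)s · s' + s · ρ(Y)s'` (the differential of
  `tensorSpaceMulEquiv_map_tensorSpaceActOver`, `g·(s·s') = (g·s)·(g·s')`).
* §2 `eq_zero_of_tmul_add_tmul_eq_zero` — over a field of characteristic `≠ 2`: `u ⊗ t + t ⊗ u = 0`, `t ≠ 0` ⟹ `u = 0`.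
* §3 `tensorSpaceMulEquiv_hodgeTensorBasis`, `tensorDegree_append` — concatenation multiplies tensor-basis vectors and adds
  total degrees; `tensorSpaceMulEquiv_mem_span_degree` — it maps (degree-`p` span) ⊗ (degree-`p'` span) into the
  degree-`(p + p')` span.
* §4 **`tensorSpaceMulEquiv_mem_hodgeClasses_zero`** — for a pure `ℚ`-Hodge structure `H` and rational Hodge classes
  `t ∈ T^{a,b}` of type `(p,p)`, `s ∈ T^{c,d}` of type `(−p,−p)`: the concatenation `t · s ∈ T^{a+c,b+d}` is a weight-`0` Hodge
  class of type `(0,0)` (Deligne, Hodge II, 1.1.12: the product of `F^p` and `F^{p'}` lies in `F^{p+p'}`).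

## References
* [Deligne1982HodgeCycles] P. Deligne, *Hodge cycles on abelian varieties*, LNM 900 (1982), I §3.1 and Prop. 3.4.
  [cite: Deligne1982HodgeCycles, I §3.1]
* [DeligneHodgeII1971] P. Deligne, *Théorie de Hodge II*, 1.1.12 and 1.2.5. [cite: DeligneHodgeII1971, 1.1.12 and 1.2.5]
-/

noncomputable section

open scoped TensorProduct PiTensorProduct

namespace Literature.AlgebraicGeometry.Motives

universe u v w

/-! ### §1 The Leibniz rule for concatenation -/

section Leibniz

variable {K : Type u} [Field K] {W : Type v} [AddCommGroup W] [Module K W]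

/-- Left and right blocks of `Fin (a + c)` are disjoint. [folklore] -/
private theorem castAdd_ne_natAdd {a c : ℕ} (i : Fin a) (j : Fin c) : Fin.castAdd c i ≠ Fin.natAdd a j := by
  intro h
  have h' := congrArg Fin.val h
  rw [Fin.val_castAdd, Fin.val_natAdd] at h'
  have := i.2
  omega

/-- Updating a concatenated tuple in the left block. [cite: Deligne1982HodgeCycles, I §3.1] -/
private theorem append_update_left {α : Type v} {a c : ℕ} (v : Fin a → α) (w : Fin c → α) (k : Fin a) (x : α) :
    Fin.append (Function.update v k x) w = Function.update (Fin.append v w) (Fin.castAdd c k) x := by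
  funext i
  refine Fin.addCases (fun i => ?_) (fun j => ?_) i
  · rw [Fin.append_left]
    by_cases hik : i = k
    · subst hik; rw [Function.update_self, Function.update_self]
    · rw [Function.update_of_ne hik, Function.update_of_ne (fun h => hik (Fin.castAdd_injective _ _ h)), Fin.append_left]
  · rw [Fin.append_right, Function.update_of_ne (fun h => castAdd_ne_natAdd k j h.symm), Fin.append_right]

/-- Updating a concatenated tuple in the right block. [cite: Deligne1982HodgeCycles, I §3.1] -/
private theorem append_update_right {α : Type v} {a c : ℕ} (v : Fin a → α) (w : Fin c → α) (l : Fin c) (x : α) :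
    Fin.append v (Function.update w l x) = Function.update (Fin.append v w) (Fin.natAdd a l) x := by
  funext i
  refine Fin.addCases (fun i => ?_) (fun j => ?_) i
  · rw [Fin.append_left, Function.update_of_ne (castAdd_ne_natAdd i l), Fin.append_left]
  · rw [Fin.append_right]
    by_cases hjl : j = l
    · subst hjl; rw [Function.update_self, Function.update_self]
    · rw [Function.update_of_ne hjl, Function.update_of_ne (fun h => hjl (Fin.natAdd_injective _ _ h)), Fin.append_right]

/-- **The Leibniz action is a derivation of the concatenation of tensor powers**:
`D_{a+c}(Y)(x · y) = D_a(Y)x · y + x · D_c(Y)y` under `TensorPower.mulEquiv : W^{⊗a} ⊗ W^{⊗c} ≃ W^{⊗(a+c)}`.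
[cite: Deligne1982HodgeCycles, I §3.1] -/
theorem piTensorDerivation_mulEquiv (Y : Module.End K W) {a c : ℕ} (x : ⨂[K]^a W) (y : ⨂[K]^c W) :
    piTensorDerivation (a + c) Y (TensorPower.mulEquiv (x ⊗ₜ[K] y)) =
      TensorPower.mulEquiv (piTensorDerivation a Y x ⊗ₜ[K] y) + TensorPower.mulEquiv (x ⊗ₜ[K] piTensorDerivation c Y y) := by
  suffices h : piTensorDerivation (a + c) Y ∘ₗ
      (TensorPower.mulEquiv : (⨂[K]^a W) ⊗[K] (⨂[K]^c W) ≃ₗ[K] ⨂[K]^(a + c) W).toLinearMap =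
      (TensorPower.mulEquiv : (⨂[K]^a W) ⊗[K] (⨂[K]^c W) ≃ₗ[K] ⨂[K]^(a + c) W).toLinearMap ∘ₗ
        ((piTensorDerivation a Y).rTensor (⨂[K]^c W) + (piTensorDerivation c Y).lTensor (⨂[K]^a W)) by
    have h' := LinearMap.congr_fun h (x ⊗ₜ[K] y)
    simpa using h'
  ext v w
  simp only [LinearMap.compMultilinearMap_apply, TensorProduct.AlgebraTensorModule.curry_apply, LinearMap.coe_restrictScalars,
    TensorProduct.curry_apply, LinearMap.coe_comp, LinearEquiv.coe_coe, Function.comp_apply, mulEquiv_tprod_tmul_tprod,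
    piTensorDerivation_tprod, LinearMap.add_apply, LinearMap.rTensor_tmul, LinearMap.lTensor_tmul, map_add,
    TensorProduct.sum_tmul, TensorProduct.tmul_sum, map_sum, Fin.sum_univ_add, append_update_left, append_update_right,
    Fin.append_left, Fin.append_right]

/-- **The derivation action is a derivation of the concatenation `T^{a,b} ⊗ T^{c,d} → T^{a+c,b+d}`**:
`ρ(Y)(s · s') = ρ(Y)s · s' + s · ρ(Y)s'` (`·` = `tensorSpaceMulEquiv`; the differential of the equivariance
`g · (s · s') = (g · s) · (g · s')`, `tensorSpaceMulEquiv_map_tensorSpaceActOver`). [cite: Deligne1982HodgeCycles, I §3.1] -/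
theorem tensorDerivation_tensorSpaceMulEquiv (Y : Module.End K W) {a b c d : ℕ} (s : hodgeTensorSpaceOver K W a b)
    (s' : hodgeTensorSpaceOver K W c d) :
    tensorDerivation (a + c) (b + d) Y (tensorSpaceMulEquiv a b c d (s ⊗ₜ[K] s')) =
      tensorSpaceMulEquiv a b c d (tensorDerivation a b Y s ⊗ₜ[K] s') +
        tensorSpaceMulEquiv a b c d (s ⊗ₜ[K] tensorDerivation c d Y s') := by
  induction s using TensorProduct.induction_on with
  | zero => simp only [TensorProduct.zero_tmul, map_zero, zero_add]
  | tmul x ξ =>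
    induction s' using TensorProduct.induction_on with
    | zero => simp only [TensorProduct.tmul_zero, map_zero, add_zero]
    | tmul x' ξ' =>
      simp only [tensorSpaceMulEquiv, LinearEquiv.trans_apply, TensorProduct.tensorTensorTensorComm_tmul,
        TensorProduct.congr_tmul, tensorDerivation_apply, LinearMap.sub_apply, LinearMap.rTensor_tmul,
        LinearMap.lTensor_tmul, TensorProduct.sub_tmul, TensorProduct.tmul_sub, map_sub, piTensorDerivation_mulEquiv,
        TensorProduct.add_tmul, TensorProduct.tmul_add]
      abel
    | add y₁ y₂ h₁ h₂ =>
      simp only [TensorProduct.tmul_add, map_add, h₁, h₂]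
      abel
  | add x₁ x₂ h₁ h₂ =>
    simp only [TensorProduct.add_tmul, map_add, h₁, h₂]
    abel

end Leibniz

/-! ### §2 Cancellation: `u ⊗ t + t ⊗ u = 0` forces `u = 0` -/

section Cancel

variable {K : Type u} [Field K] [CharZero K] {M : Type v} [AddCommGroup M] [Module K M]

/-- **Cancellation in `M ⊗ M` (characteristic `0`)**: if `t ≠ 0` and `u ⊗ t + t ⊗ u = 0` then `u = 0` (apply `id ⊗ φ` with
`φ(t) = 1`: `u = −φ(u) t`, whence `2 φ(u) (t ⊗ t) = 0`). [cite: Deligne1982HodgeCycles, I §3.1] -/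
theorem eq_zero_of_tmul_add_tmul_eq_zero {u t : M} (ht : t ≠ 0) (h : u ⊗ₜ[K] t + t ⊗ₜ[K] u = 0) : u = 0 := by
  obtain ⟨φ, hφ⟩ := Module.Projective.exists_dual_eq_one K ht
  -- contract the second factor with `φ`: `u + φ(u) t = 0`
  have h1 : u + φ u • t = 0 := by
    have h' := congrArg ((TensorProduct.rid K M).toLinearMap ∘ₗ LinearMap.lTensor M φ) h
    simpa [hφ] using h'
  -- contract both factors with `φ`: `2 φ(u) = 0`
  have h2 : φ u = 0 := by
    have h' := congrArg φ h1
    rw [map_add, map_smul, hφ, smul_eq_mul, mul_one, map_zero, ← two_mul] at h'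
    exact (mul_eq_zero.1 h').resolve_left two_ne_zero
  rw [h2, zero_smul, add_zero] at h1
  exact h1

end Cancel

/-! ### §3 Concatenation of tensor-basis vectors; additivity of the total degree -/

section Degree

variable {K : Type u} [Field K] {W : Type v} [AddCommGroup W] [Module K W] {S : Type w} [Fintype S] [DecidableEq S]
  (e : Module.Basis S K W) (deg : S → ℤ)

/-- **Concatenation multiplies tensor-basis vectors**: `E(β,γ) · E(β',γ') = E(β ++ β', γ ++ γ')`.
[cite: Deligne1982HodgeCycles, I §3.1] -/
theorem tensorSpaceMulEquiv_hodgeTensorBasis {a b c d : ℕ} (x : (Fin a → S) × (Fin b → S)) (y : (Fin c → S) × (Fin d → S)) :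
    tensorSpaceMulEquiv a b c d (hodgeTensorBasis e a b x ⊗ₜ[K] hodgeTensorBasis e c d y) =
      hodgeTensorBasis e (a + c) (b + d) (Fin.append x.1 y.1, Fin.append x.2 y.2) := by
  obtain ⟨β, γ⟩ := x
  obtain ⟨β', γ'⟩ := y
  rw [hodgeTensorBasis_apply, hodgeTensorBasis_apply, hodgeTensorBasis_apply, tensorSpaceMulEquiv_tmul,
    append_comp_apply e β β', append_comp_apply e.dualBasis γ γ']

omit [Fintype S] [DecidableEq S] in
/-- **The total degree is additive under concatenation.** [cite: DeligneHodgeII1971, 1.1.12 and 1.2.5] -/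
theorem tensorDegree_append {a b c d : ℕ} (x : (Fin a → S) × (Fin b → S)) (y : (Fin c → S) × (Fin d → S)) :
    tensorDegree deg (Fin.append x.1 y.1, Fin.append x.2 y.2) = tensorDegree deg x + tensorDegree deg y := by
  simp only [tensorDegree_apply, Fin.sum_univ_add, Fin.append_left, Fin.append_right]
  ring

/-- **Concatenation maps (degree-`p` span) ⊗ (degree-`p'` span) into the degree-`(p + p')` span** of the tensor basis.
[cite: DeligneHodgeII1971, 1.1.12 and 1.2.5] -/
theorem tensorSpaceMulEquiv_mem_span_degree {a b c d : ℕ} {p p' : ℤ} {s : hodgeTensorSpaceOver K W a b}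
    {s' : hodgeTensorSpaceOver K W c d} (hs : s ∈ Submodule.span K (hodgeTensorBasis e a b '' {x | tensorDegree deg x = p}))
    (hs' : s' ∈ Submodule.span K (hodgeTensorBasis e c d '' {y | tensorDegree deg y = p'})) :
    tensorSpaceMulEquiv a b c d (s ⊗ₜ[K] s') ∈
      Submodule.span K (hodgeTensorBasis e (a + c) (b + d) '' {z | tensorDegree deg z = p + p'}) := by
  induction hs using Submodule.span_induction with
  | mem u hu =>
    obtain ⟨x, hx, rfl⟩ := hu
    induction hs' using Submodule.span_induction with
    | mem u' hu' =>
      obtain ⟨y, hy, rfl⟩ := hu'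
      rw [tensorSpaceMulEquiv_hodgeTensorBasis]
      refine Submodule.subset_span ⟨_, ?_, rfl⟩
      simp only [Set.mem_setOf_eq] at hx hy ⊢
      rw [tensorDegree_append, hx, hy]
    | zero => rw [TensorProduct.tmul_zero, map_zero]; exact Submodule.zero_mem _
    | add y₁ y₂ _ _ h₁ h₂ => rw [TensorProduct.tmul_add, map_add]; exact Submodule.add_mem _ h₁ h₂
    | smul r y _ hy => rw [TensorProduct.tmul_smul, map_smul]; exact Submodule.smul_mem _ r hy
  | zero => rw [TensorProduct.zero_tmul, map_zero]; exact Submodule.zero_mem _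
  | add x₁ x₂ _ _ h₁ h₂ => rw [TensorProduct.add_tmul, map_add]; exact Submodule.add_mem _ h₁ h₂
  | smul r x _ hx => rw [← TensorProduct.smul_tmul', map_smul]; exact Submodule.smul_mem _ r hx

end Degree

/-! ### §4 Products of Hodge tensors of opposite types are weight-`0` Hodge tensors of type `(0,0)` -/

section Hodge

variable {V : Type u} [AddCommGroup V] [Module ℚ V] [Module.Finite ℚ V] [HodgeTensorFacts.{u, u}] {n : ℤ}
  (H : HodgeStructure V n)

/-- **The concatenation of a Hodge tensor of type `(p,p)` and one of type `(−p,−p)` is a weight-`0` Hodge tensor of type `(0,0)`**: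
for rational `t ∈ T^{a,b}` with `1 ⊗ t ∈ Hdg^p` (`(a−b)n = 2p`) and `s ∈ T^{c,d}` with `1 ⊗ s ∈ Hdg^{p'}` (`(c−d)n = 2p'`),
`p + p' = 0`: `t · s ∈ Hdg⁰(T^{a+c,b+d})` — in a graded basis the complexifications lie in the spans of the tensor-basis vectors of
total degrees `p` and `p'` (`tensorSpaceToBaseChange_mem_span_degree_eq`), concatenation adds degrees, and a rational tensor whose
complexification has total degree `0` is a Hodge class of type `(0,0)` (`mem_hodgeClasses_of_mem_span_degree_zero`).
[cite: DeligneHodgeII1971, 1.1.12 and 1.2.5] [cite: Deligne1982HodgeCycles, I §3.1] -/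
theorem HodgeStructure.tensorSpaceMulEquiv_mem_hodgeClasses_zero {a b c d : ℕ} {p p' : ℤ} (hab : ((a : ℤ) - b) * n = 2 * p)
    (hcd : ((c : ℤ) - d) * n = 2 * p') (hpp : p + p' = 0) {t : hodgeTensorSpace V a b}
    (ht : t ∈ (H.tensorSpace a b).hodgeClasses p) {s : hodgeTensorSpace V c d} (hs : s ∈ (H.tensorSpace c d).hodgeClasses p') :
    tensorSpaceMulEquiv a b c d (t ⊗ₜ[ℚ] s) ∈ (H.tensorSpace (a + c) (b + d)).hodgeClasses 0 := by
  classical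
  obtain ⟨S, deg, e, hF, hFc⟩ := HodgeStructure.exists_basis_F_eq_span H
  haveI : Fintype S := FiniteDimensional.fintypeBasisIndex e
  apply HodgeStructure.mem_hodgeClasses_of_mem_span_degree_zero H e hF
  rw [← tensorSpaceMulEquiv_tensorSpaceToBaseChange]
  have h := tensorSpaceMulEquiv_mem_span_degree e deg
    (HodgeStructure.tensorSpaceToBaseChange_mem_span_degree_eq H e hF hFc hab ht)
    (HodgeStructure.tensorSpaceToBaseChange_mem_span_degree_eq H e hF hFc hcd hs)
  rwa [hpp] at h

end Hodge

end Literature.AlgebraicGeometry.Motives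

end
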